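import Summits.QuantumAdvantage.QuantumAdvantage.Theorems.LinnikCubicClassGroupsDegreeOnePrimesEscapeCubicSplittingCount
import Literature.NumberTheory.LFunctions.DegreeOnePrimesPNT
import Mathlib.NumberTheory.Chebyshev
import HarnessLib

/-!
# Splitting types in an `S₃`-sextic, summed over the primes `p ≤ x`

Topic `Summits/QuantumAdvantage/QuantumAdvantage/Theorems`, cell B2b-1 (linnik-cubic), PART A (gen 7);
helper toward the crux `DegreeOnePrimesEscape` (stmt-QuantumAdvantage-11543) of route
`LinnikCubicClassGroups`.  HONEST FRAMING: the value of this file is a THEOREM (kernel-checked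
bookkeeping) — NOT summit progress.

Let `N/ℚ` be Galois of degree `6` with non-abelian group, `K ⊂ N` cubic, `k ⊂ N` quadratic, and write
`θ¹_E(x) = Σ_{p ≤ x} a_E(p) log p` for the Chebyshev function of the degree-one primes of `E`
(`Literature.NumberTheory.LFunctions.NumberField.degreeOneTheta`, `a_E(p) = #{𝔭 ∣ p : f(𝔭|p) = 1}`) and
`θ = θ_ℚ` for Chebyshev's function.  Summing the prime-by-prime dictionary of
`…CubicSplittingCount.lean` over `p ≤ x` (the `≤ ω(d_N)` primes dividing `d_N` cost at most a multiple
of `log|d_N|`):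

* `three_mul_inertSum_ge` — `θ(x) + θ¹_k(x) − θ¹_K(x) − 3 log|d_N| ≤ 3·Σ_{p ≤ x inert in K, p ∤ d_N} log p`;
* `six_mul_inertSum_ge` — `3 θ¹_k(x) − θ¹_N(x) − 6 log|d_N| ≤ 6·Σ_{p ≤ x inert in K, p ∤ d_N} log p`;
* `two_mul_partialSum_ge` — `2 θ(x) − θ¹_k(x) − 2 log|d_N| ≤ 2·Σ_{p ≤ x of type (1,2) in K, p ∤ d_N} log p`;
* `six_mul_splitSum_ge` — `θ¹_N(x) − 6 log|d_N| ≤ 6·Σ_{p ≤ x completely split in K, p ∤ d_N} log p`.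

(`degreeOneTheta_eq_of_algEquiv`: `θ¹` is an isomorphism invariant.)  These are the exact finite forms of `π_σ = (θ_1 + θ_sgn − θ_std)/3`, `π_τ = (θ_1 − θ_sgn)/2`,
`π_1 = θ¹_N/6` for the three conjugacy classes of `S₃`.
-/

noncomputable section

open scoped NumberField nonZeroDivisors
open Finset Real Ideal NumberField
open Literature.NumberTheory.NumberFields Literature.NumberTheory.LFunctions
  Literature.NumberTheory.LFunctions.NumberField

namespace Summit.QuantumAdvantage.QuantumAdvantage.Theorems.DegreeOnePrimesEscape

/-! ### Rewriting the Chebyshev functions as sums over the primes `p ≤ x` -/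

/-- `θ¹_E(x) = Σ_{p ≤ x} a_E(p) log p` with `a_E(p) = (splittingType E p).count 1`. -/
theorem degreeOneTheta_eq_sum_count_one (E : Type*) [Field E] [NumberField E] (x : ℝ) :
    degreeOneTheta E x =
      ∑ p ∈ Nat.primesLE ⌊x⌋₊, (((splittingType E p).count 1 : ℕ) : ℝ) * Real.log p := by
  rw [degreeOneTheta]
  refine Finset.sum_congr rfl fun p hp => ?_
  rw [idealNormCount_eq_count_one_splittingType (Nat.mem_primesLE.mp hp).2]

/-- **The ramified primes are cheap**: `Σ_{p ≤ n prime, p ∣ d} log p ≤ log d` for `d ≠ 0`. -/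
theorem sum_primesLE_filter_dvd_log_le {d : ℕ} (hd : d ≠ 0) (n : ℕ) :
    ∑ p ∈ (Nat.primesLE n).filter (· ∣ d), Real.log p ≤ Real.log d := by
  have hsub : (Nat.primesLE n).filter (· ∣ d) ⊆ d.primeFactors := by
    intro p hp
    rw [Finset.mem_filter] at hp
    exact Nat.mem_primeFactors.mpr ⟨(Nat.mem_primesLE.mp hp.1).2, hp.2, hd⟩
  have hpos : ∀ p ∈ d.primeFactors, (0 : ℝ) < p := fun p hp =>
    by exact_mod_cast (Nat.prime_of_mem_primeFactors hp).pos
  calc ∑ p ∈ (Nat.primesLE n).filter (· ∣ d), Real.log p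
      ≤ ∑ p ∈ d.primeFactors, Real.log p :=
        Finset.sum_le_sum_of_subset_of_nonneg hsub fun p _ _ => Real.log_natCast_nonneg p
    _ = Real.log (∏ p ∈ d.primeFactors, (p : ℝ)) :=
        (Real.log_prod (fun p hp => (hpos p hp).ne')).symm
    _ ≤ Real.log d := by
        refine Real.log_le_log (Finset.prod_pos hpos) ?_
        have h := Nat.le_of_dvd (Nat.pos_of_ne_zero hd) (Nat.prod_primeFactors_dvd d)
        rw [← Nat.cast_prod]
        exact_mod_cast h

/-- The same with the divisibility stated over `ℤ` against `d_N`: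
`Σ_{p ≤ n prime, p ∣ d_N} log p ≤ log|d_N|`. -/
theorem sum_primesLE_filter_dvd_discr_log_le (N : Type*) [Field N] [NumberField N] (n : ℕ) :
    ∑ p ∈ (Nat.primesLE n).filter (fun p : ℕ => (p : ℤ) ∣ NumberField.discr N), Real.log p ≤
      Real.log ((NumberField.discr N).natAbs : ℝ) := by
  have hd : (NumberField.discr N).natAbs ≠ 0 := Int.natAbs_ne_zero.mpr (NumberField.discr_ne_zero N)
  have h := sum_primesLE_filter_dvd_log_le hd n
  have hfilt : (Nat.primesLE n).filter (fun p : ℕ => (p : ℤ) ∣ NumberField.discr N) =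
      (Nat.primesLE n).filter (· ∣ (NumberField.discr N).natAbs) :=
    Finset.filter_congr fun p _ => Int.natCast_dvd
  rw [hfilt]
  exact h

/-! ### The four summed inequalities -/

section Sextic

variable {N : Type*} [Field N] [NumberField N] [IsGalois ℚ N]

omit [IsGalois ℚ N] in
/-- **Generic summation step**: if `u(p) ≤ c·𝟙[P p]` at the primes `p ∤ d_N` and `u(p) ≤ c` at the
primes `p ∣ d_N`, then `Σ_{p ≤ n} u(p) log p − c log|d_N| ≤ c Σ_{p ≤ n, p ∤ d_N, P p} log p`. -/
theorem sum_le_of_pointwise (c : ℝ) (hc : 0 ≤ c) (u : ℕ → ℝ) (P : ℕ → Prop)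
    [DecidablePred P] (n : ℕ)
    (h : ∀ p ∈ Nat.primesLE n, ¬ ((p : ℤ) ∣ NumberField.discr N) → u p ≤ c * (if P p then 1 else 0))
    (h' : ∀ p ∈ Nat.primesLE n, (p : ℤ) ∣ NumberField.discr N → u p ≤ c) :
    ∑ p ∈ Nat.primesLE n, u p * Real.log p - c * Real.log ((NumberField.discr N).natAbs : ℝ) ≤
      c * ∑ p ∈ (Nat.primesLE n).filter (fun p : ℕ => ¬ ((p : ℤ) ∣ NumberField.discr N) ∧ P p),
        Real.log p := by
  classical
  have hram := sum_primesLE_filter_dvd_discr_log_le N n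
  rw [Finset.sum_filter] at hram ⊢
  rw [Finset.mul_sum]
  have hpt : ∀ p ∈ Nat.primesLE n, u p * Real.log p -
      c * (if (p : ℤ) ∣ NumberField.discr N then Real.log p else 0) ≤
      c * (if ¬ ((p : ℤ) ∣ NumberField.discr N) ∧ P p then Real.log p else 0) := by
    intro p hp
    have hlog : 0 ≤ Real.log p := Real.log_natCast_nonneg p
    by_cases hdvd : (p : ℤ) ∣ NumberField.discr N
    · rw [if_pos hdvd, if_neg (fun h => h.1 hdvd), mul_zero]
      have := h' p hp hdvd
      nlinarith
    · rw [if_neg hdvd, mul_zero, sub_zero]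
      have := h p hp hdvd
      by_cases hP : P p
      · rw [if_pos ⟨hdvd, hP⟩]
        rw [if_pos hP, mul_one] at this
        exact mul_le_mul_of_nonneg_right this hlog
      · rw [if_neg (fun h => hP h.2), mul_zero]
        rw [if_neg hP, mul_zero] at this
        nlinarith
  have hsum := Finset.sum_le_sum hpt
  rw [Finset.sum_sub_distrib, ← Finset.mul_sum] at hsum
  nlinarith

/-- **Inert primes, `(ℚ, k, K)`-form, summed**:
`θ(x) + θ¹_k(x) − θ¹_K(x) − 3 log|d_N| ≤ 3 Σ_{p ≤ x, p ∤ d_N, a_K(p) = 0} log p`. -/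
theorem three_mul_inertSum_ge (h6 : Module.finrank ℚ N = 6)
    (hna : ∃ g h : N ≃ₐ[ℚ] N, g * h ≠ h * g) (K k : IntermediateField ℚ N)
    (hK : Module.finrank ℚ K = 3) (hk : Module.finrank ℚ k = 2) (x : ℝ) :
    Chebyshev.theta x + degreeOneTheta k x - degreeOneTheta K x -
        3 * Real.log ((NumberField.discr N).natAbs : ℝ) ≤
      3 * ∑ p ∈ (Nat.primesLE ⌊x⌋₊).filter
        (fun p : ℕ => ¬ ((p : ℤ) ∣ NumberField.discr N) ∧ (splittingType K p).count 1 = 0), Real.log p := by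
  classical
  have h := sum_le_of_pointwise (N := N) 3 (by norm_num)
    (fun p => 1 + (((splittingType k p).count 1 : ℕ) : ℝ) - (((splittingType K p).count 1 : ℕ) : ℝ))
    (fun p => (splittingType K p).count 1 = 0) ⌊x⌋₊ ?_ ?_
  · rw [Chebyshev.theta_eq_sum_primesLE, degreeOneTheta_eq_sum_count_one,
      degreeOneTheta_eq_sum_count_one]
    refine le_trans (le_of_eq ?_) h
    rw [← Finset.sum_add_distrib, ← Finset.sum_sub_distrib]
    refine congrArg₂ _ (Finset.sum_congr rfl fun p _ => by ring) rfl
  · intro p hp hd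
    have hp' := (Nat.mem_primesLE.mp hp).2
    have hid := sextic_three_mul_inert_add h6 hna K k hK hk hp' hd
    split_ifs at hid ⊢ with h0
    · have : (((splittingType k p).count 1 : ℕ) : ℝ) = (((splittingType K p).count 1 : ℕ) : ℝ) + 2 := by
        exact_mod_cast (by omega)
      rw [this]; ring_nf; rfl
    · have : (1 : ℝ) + (((splittingType k p).count 1 : ℕ) : ℝ) = (((splittingType K p).count 1 : ℕ) : ℝ) := by
        exact_mod_cast (by omega)
      linarith
  · intro p hp _
    have hp' := (Nat.mem_primesLE.mp hp).2
    have hk2 := count_one_splittingType_le_finrank (K := k) hp'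
    rw [hk] at hk2
    have hk2' : (((splittingType k p).count 1 : ℕ) : ℝ) ≤ 2 := by exact_mod_cast hk2
    have hK0 : (0 : ℝ) ≤ (((splittingType K p).count 1 : ℕ) : ℝ) := Nat.cast_nonneg _
    linarith

/-- **Inert primes, `(k, N)`-form, summed**:
`3 θ¹_k(x) − θ¹_N(x) − 6 log|d_N| ≤ 6 Σ_{p ≤ x, p ∤ d_N, a_K(p) = 0} log p`. -/
theorem six_mul_inertSum_ge (h6 : Module.finrank ℚ N = 6)
    (hna : ∃ g h : N ≃ₐ[ℚ] N, g * h ≠ h * g) (K k : IntermediateField ℚ N)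
    (hK : Module.finrank ℚ K = 3) (hk : Module.finrank ℚ k = 2) (x : ℝ) :
    3 * degreeOneTheta k x - degreeOneTheta N x -
        6 * Real.log ((NumberField.discr N).natAbs : ℝ) ≤
      6 * ∑ p ∈ (Nat.primesLE ⌊x⌋₊).filter
        (fun p : ℕ => ¬ ((p : ℤ) ∣ NumberField.discr N) ∧ (splittingType K p).count 1 = 0), Real.log p := by
  classical
  have h := sum_le_of_pointwise (N := N) 6 (by norm_num)
    (fun p => 3 * (((splittingType k p).count 1 : ℕ) : ℝ) - (((splittingType N p).count 1 : ℕ) : ℝ))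
    (fun p => (splittingType K p).count 1 = 0) ⌊x⌋₊ ?_ ?_
  · rw [degreeOneTheta_eq_sum_count_one, degreeOneTheta_eq_sum_count_one]
    refine le_trans (le_of_eq ?_) h
    rw [Finset.mul_sum, ← Finset.sum_sub_distrib]
    refine congrArg₂ _ (Finset.sum_congr rfl fun p _ => by ring) rfl
  · intro p hp hd
    have hp' := (Nat.mem_primesLE.mp hp).2
    have hid := sextic_six_mul_inert_add h6 hna K k hK hk hp' hd
    split_ifs at hid ⊢ with h0
    · have : 3 * (((splittingType k p).count 1 : ℕ) : ℝ) = (((splittingType N p).count 1 : ℕ) : ℝ) + 6 := by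
        exact_mod_cast (by omega)
      linarith
    · have : 3 * (((splittingType k p).count 1 : ℕ) : ℝ) = (((splittingType N p).count 1 : ℕ) : ℝ) := by
        exact_mod_cast (by omega)
      linarith
  · intro p hp _
    have hp' := (Nat.mem_primesLE.mp hp).2
    have hk2 := count_one_splittingType_le_finrank (K := k) hp'
    rw [hk] at hk2
    have hk2' : (((splittingType k p).count 1 : ℕ) : ℝ) ≤ 2 := by exact_mod_cast hk2
    have hN0 : (0 : ℝ) ≤ (((splittingType N p).count 1 : ℕ) : ℝ) := Nat.cast_nonneg _
    linarith

/-- **Partially split primes (type `(1,2)` in `K` = inert in `k`), summed**: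
`2 θ(x) − θ¹_k(x) − 2 log|d_N| ≤ 2 Σ_{p ≤ x, p ∤ d_N, a_K(p) = 1} log p`. -/
theorem two_mul_partialSum_ge (h6 : Module.finrank ℚ N = 6)
    (hna : ∃ g h : N ≃ₐ[ℚ] N, g * h ≠ h * g) (K k : IntermediateField ℚ N)
    (hK : Module.finrank ℚ K = 3) (hk : Module.finrank ℚ k = 2) (x : ℝ) :
    2 * Chebyshev.theta x - degreeOneTheta k x -
        2 * Real.log ((NumberField.discr N).natAbs : ℝ) ≤
      2 * ∑ p ∈ (Nat.primesLE ⌊x⌋₊).filter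
        (fun p : ℕ => ¬ ((p : ℤ) ∣ NumberField.discr N) ∧ (splittingType K p).count 1 = 1), Real.log p := by
  classical
  have h := sum_le_of_pointwise (N := N) 2 (by norm_num)
    (fun p => 2 - (((splittingType k p).count 1 : ℕ) : ℝ))
    (fun p => (splittingType K p).count 1 = 1) ⌊x⌋₊ ?_ ?_
  · rw [Chebyshev.theta_eq_sum_primesLE, degreeOneTheta_eq_sum_count_one]
    refine le_trans (le_of_eq ?_) h
    rw [Finset.mul_sum, ← Finset.sum_sub_distrib]
    refine congrArg₂ _ (Finset.sum_congr rfl fun p _ => by ring) rfl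
  · intro p hp hd
    have hp' := (Nat.mem_primesLE.mp hp).2
    have hid := sextic_two_mul_partial_add h6 hna K k hK hk hp' hd
    split_ifs at hid ⊢ with h0
    · have : (((splittingType k p).count 1 : ℕ) : ℝ) = 0 := by exact_mod_cast (by omega)
      rw [this]; norm_num
    · have : (((splittingType k p).count 1 : ℕ) : ℝ) = 2 := by exact_mod_cast (by omega)
      rw [this]; norm_num
  · intro p hp _
    have hk0 : (0 : ℝ) ≤ (((splittingType k p).count 1 : ℕ) : ℝ) := Nat.cast_nonneg _
    linarith

/-- **Completely split primes, summed**: `θ¹_N(x) − 6 log|d_N| ≤ 6 Σ_{p ≤ x, p ∤ d_N, a_K(p) = 3} log p`. -/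
theorem six_mul_splitSum_ge (h6 : Module.finrank ℚ N = 6)
    (hna : ∃ g h : N ≃ₐ[ℚ] N, g * h ≠ h * g) (K k : IntermediateField ℚ N)
    (hK : Module.finrank ℚ K = 3) (hk : Module.finrank ℚ k = 2) (x : ℝ) :
    degreeOneTheta N x - 6 * Real.log ((NumberField.discr N).natAbs : ℝ) ≤
      6 * ∑ p ∈ (Nat.primesLE ⌊x⌋₊).filter
        (fun p : ℕ => ¬ ((p : ℤ) ∣ NumberField.discr N) ∧ (splittingType K p).count 1 = 3), Real.log p := by
  classical
  have h := sum_le_of_pointwise (N := N) 6 (by norm_num)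
    (fun p => (((splittingType N p).count 1 : ℕ) : ℝ))
    (fun p => (splittingType K p).count 1 = 3) ⌊x⌋₊ ?_ ?_
  · rw [degreeOneTheta_eq_sum_count_one]
    exact h
  · intro p hp hd
    have hp' := (Nat.mem_primesLE.mp hp).2
    have hid := sextic_count_one_eq_six_mul_split h6 hna K k hK hk hp' hd
    split_ifs at hid ⊢ with h0
    · have : (((splittingType N p).count 1 : ℕ) : ℝ) = 6 := by exact_mod_cast (by omega)
      rw [this]; norm_num
    · have : (((splittingType N p).count 1 : ℕ) : ℝ) = 0 := by exact_mod_cast (by omega)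
      rw [this]; norm_num
  · intro p hp _
    have hp' := (Nat.mem_primesLE.mp hp).2
    have hN6 := count_one_splittingType_le_finrank (K := N) hp'
    rw [h6] at hN6
    exact_mod_cast hN6

end Sextic

/-! ### From a positive sum to a prime -/

/-- If `Σ_{p ≤ x prime, P p} log p > 0` then some prime `p ≤ x` satisfies `P`. -/
theorem exists_prime_of_sum_log_pos {P : ℕ → Prop} [DecidablePred P] {x : ℝ}
    (h : 0 < ∑ p ∈ (Nat.primesLE ⌊x⌋₊).filter P, Real.log p) :
    ∃ p : ℕ, p.Prime ∧ (p : ℝ) ≤ x ∧ P p := by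
  obtain ⟨p, hp, -⟩ := Finset.exists_ne_zero_of_sum_ne_zero h.ne'
  rw [Finset.mem_filter, Nat.mem_primesLE] at hp
  have hx : 0 ≤ x := by
    by_contra hx
    push Not at hx
    rw [Nat.floor_of_nonpos hx.le] at hp
    have := hp.1.2.two_le
    omega
  exact ⟨p, hp.1.2, (Nat.cast_le.mpr hp.1.1).trans (Nat.floor_le hx), hp.2⟩

/-- **`θ¹` is an isomorphism invariant**: `ℚ`-isomorphic number fields have the same splitting types
(`ArithmeticallyEquivalent.of_algEquiv`), hence the same `θ¹`. [folklore] -/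
theorem degreeOneTheta_eq_of_algEquiv {E E' : Type*} [Field E] [NumberField E] [Field E']
    [NumberField E'] (e : E ≃ₐ[ℚ] E') (x : ℝ) : degreeOneTheta E x = degreeOneTheta E' x := by
  rw [degreeOneTheta_eq_sum_count_one, degreeOneTheta_eq_sum_count_one]
  refine Finset.sum_congr rfl fun p hp => ?_
  rw [ArithmeticallyEquivalent.of_algEquiv e p (Nat.mem_primesLE.mp hp).2]

end Summit.QuantumAdvantage.QuantumAdvantage.Theorems.DegreeOnePrimesEscape

end
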